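import Literature.MathematicalPhysics.QuantumFieldTheory.AnisotropicTwistedPartitionFunctionStrongCoupling
import Literature.MathematicalPhysics.QuantumFieldTheory.PlaquetteSystemTwistAgreementRate
import HarnessLib

/-!
# The anisotropic strong-coupling twist bound WITH RATE: `|ln Z_z(L_s,L_t) - ln Z_1(L_s,L_t)| ≤ 12 L_s³ L_t (4·97²e·N|β|)^{L_s²}`

Topic `Literature/MathematicalPhysics/QuantumFieldTheory`; sequel of `AnisotropicTwistedPartitionFunctionStrongCoupling.lean` (rate `e^{-L_s²}`) using
`PlaquetteSystemTwistAgreementRate.lean`.  THEOREMS ONLY.  The ASYMMETRIC-box twin, uniform in `L_t`, of the tree's symmetric-torus rate bound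
`CentralTwist.abs_log_twistZ_sub_log_twistZ_le_pow` (whose docstring records the TODO "Symmetric tori only … `L₃L₄ → ∞` at fixed `L₁L₂` as printed in
IS08"): K. R. Ito, E. Seiler, arXiv:0803.3019 [ItoSeiler2008Further] Thm 2.2 (1); E. T. Tomboulis, arXiv:0707.2179 [Tomboulis2007Confinement] (6.12);
G. Münster, Nucl. Phys. B180 (1981) 23.

* ★★ `abs_log_twistedPartitionFunctionAniso_sub_le_rate` — for `τ ≥ 1`, `N|β| ≤ 1`, `97² e^{1+τ}·2N|β| ≤ 1/2`, central `z`, `L_s ≥ 1`: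
  `|ln Z_z - ln Z_1| ≤ 12·L_s³L_t·e^{-τL_s²}`;
* ★★ `abs_log_twistedPartitionFunctionAniso_sub_le_pow` — for `0 < N|β| ≤ 1/(4·97²e²)`: `|ln Z_z - ln Z_1| ≤ 12·L_s³L_t·(4·97²e·N|β|)^{L_s²}`.

HONEST FRAMING: strong coupling; plane `(0,1)`; crude constants.  This is the CEILING half, on the anisotropic box, of the floor/ceiling comparison
`t_z(L_s, L_t) ≤ t_z(2L_s, L_t)` suggested for LINE g20-B (⟨stmt-QuantumFields-23465⟩, critic P2); the floor half (an anisotropic Tomboulis–Yaffe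
inequality) is NOT in the tree.  Nothing about weak coupling, confinement or a mass gap.
-/

noncomputable section

open MeasureTheory Finset
open scoped BigOperators

namespace Literature.MathematicalPhysics.QuantumFieldTheory

variable {G : Type*} [Group G] {N : ℕ} (ρ : G →* Matrix (Fin N) (Fin N) ℂ) [TopologicalSpace G]
  [IsTopologicalGroup G] [CompactSpace G] [MeasurableSpace G] [BorelSpace G] [SecondCountableTopology G] {Ls Lt : ℕ}

/-- **★★ The anisotropic strong-coupling bound WITH RATE.**  For second-countable compact `G`, continuous `ρ : G →* M_N(ℂ)`, central `z`,
`τ ≥ 1` and `β` with `N|β| ≤ 1` and `97²·e^{1+τ}·2N|β| ≤ 1/2`, every box `L_s³ × L_t` (`L_s ≥ 1`):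
`|ln Z_z(L_s,L_t) - ln Z_1(L_s,L_t)| ≤ 12 · L_s³ L_t · e^{-τ L_s²}` — uniformly in `L_t`, with the Kotecký–Preiss rate `τ` (the `β`-dependent
area-law rate of arXiv:0707.2179 (6.12) / Ito–Seiler 2008 Thm 2.2 (1) / Münster 1981 on the ASYMMETRIC box).
[cite: ItoSeiler2008Further, §2 Thm 2.2 (1)] [cite: Tomboulis2007Confinement, §6.2 eqs. (6.10)–(6.12)] -/
theorem abs_log_twistedPartitionFunctionAniso_sub_le_rate [NeZero Ls] (hρ : Continuous ρ) {β τ : ℝ} (hτ : 1 ≤ τ)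
    (hNβ1 : (N : ℝ) * |β| ≤ 1) (hsmall : ((97 : ℝ)) ^ 2 * (Real.exp (1 + τ) * (2 * N * |β|)) ≤ 1 / 2)
    {z : G} (hz : z ∈ Subgroup.center G) :
    |Real.log (twistedPartitionFunctionAniso ρ β Ls Lt z ⟨((0 : Fin 4), (1 : Fin 4)), by decide⟩) -
        Real.log (twistedPartitionFunctionAniso ρ β Ls Lt 1 ⟨((0 : Fin 4), (1 : Fin 4)), by decide⟩)| ≤
      12 * ((Ls : ℝ) ^ 3 * Lt) * Real.exp (-(τ * (Ls : ℝ) ^ 2)) := by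
  set S := finTorusSystem Ls Ls Ls Lt G with hS
  set w : FinTorusPlaquette Ls Ls Ls Lt → G → ℝ := fun _ W => Real.exp (β * ((ρ W).trace).re) with hw
  set t := finTorusStackTwist Ls Lt z (0 : Fin Ls) (0 : Fin Ls) with ht
  have hε₁ : ∀ (p : FinTorusPlaquette Ls Ls Ls Lt) (W : G), |twistFamily t w p W - 1| ≤ 2 * N * |β| := fun p W =>
    CentralTwist.abs_exp_mul_re_trace_sub_one_le ρ hρ hNβ1 _
  have hε₂ : ∀ (p : FinTorusPlaquette Ls Ls Ls Lt) (W : G), |w p W - 1| ≤ 2 * N * |β| := fun p W =>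
    CentralTwist.abs_exp_mul_re_trace_sub_one_le ρ hρ hNβ1 _
  have hsmall' : (((96 : ℕ) : ℝ) + 1) ^ 2 * (Real.exp (1 + τ) * (2 * N * |β|)) ≤ 1 / 2 := by
    norm_num at hsmall ⊢; exact hsmall
  have hsmall1 : (((96 : ℕ) : ℝ) + 1) ^ 2 * (Real.exp 2 * (2 * N * |β|)) ≤ 1 / 2 :=
    PlaquetteSystem.kpSmall_of_rate (Δ := 96) (by positivity) hτ hsmall'
  have hw₁ : ∀ p, Measurable (twistFamily t w p) := fun p =>
    (CentralTwist.measurable_exp_mul_re_trace ρ hρ β).comp (measurable_const_mul (t p))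
  have hw₂ : ∀ p, Measurable (w p) := fun p => CentralTwist.measurable_exp_mul_re_trace ρ hρ β
  have hhol : ∀ p, Measurable fun U : FinTorusLink Ls Ls Ls Lt → G => S.hol U p := measurable_finTorusSystem_hol
  have hΔ : ∀ p, (S.nbrs p).card ≤ 96 := card_nbrs_finTorusSystem_le
  have hagree : ∀ X : Finset (FinTorusPlaquette Ls Ls Ls Lt), X.card < Ls ^ 2 →
      S.polymerActivity (twistFamily t w) X = S.polymerActivity w X := fun X hX =>
    polymerActivity_finTorusStackTwist_eq_of_card_lt hz 0 0 w (by rwa [sq] at hX)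
  have hmain := S.abs_log_Z_sub_log_Z_le_of_agree_rate hhol hΔ hw₁ hw₂ hε₁ hε₂ hτ hsmall' hagree
  have hZ₁ : 0 < S.Z (twistFamily t w) := S.Z_pos_of_kpSmall hhol hw₁ hε₁ hsmall1
  have hZ₂ : 0 < S.Z w := S.Z_pos_of_kpSmall hhol hw₂ hε₂ hsmall1
  have hc : 0 < Real.exp (-(β * N)) ^ Fintype.card (FinTorusPlaquette Ls Ls Ls Lt) := pow_pos (Real.exp_pos _) _
  have h1 : twistedPartitionFunctionAniso ρ β Ls Lt z ⟨((0 : Fin 4), (1 : Fin 4)), by decide⟩ =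
      Real.exp (-(β * N)) ^ Fintype.card (FinTorusPlaquette Ls Ls Ls Lt) * S.Z (twistFamily t w) :=
    twistedPartitionFunctionAniso_eq_mul_Z ρ β z
  have h2 : twistedPartitionFunctionAniso ρ β Ls Lt 1 ⟨((0 : Fin 4), (1 : Fin 4)), by decide⟩ =
      Real.exp (-(β * N)) ^ Fintype.card (FinTorusPlaquette Ls Ls Ls Lt) * S.Z w := by
    rw [twistedPartitionFunctionAniso_eq_mul_Z ρ β (1 : G), finTorusStackTwist_one, twistFamily_one]
  rw [h1, h2, Real.log_mul hc.ne' hZ₁.ne', Real.log_mul hc.ne' hZ₂.ne', add_sub_add_left_eq_sub]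
  refine hmain.trans (le_of_eq ?_)
  rw [card_finTorusPlaquette]
  push_cast
  ring

/-- **Corollary with the explicit rate.**  For `0 < N|β| ≤ 1/(4·97²e²)` (the rate `τ := log (1/(4·97²e·N|β|)) ≥ 1` saturates the smallness):
`|ln Z_z(L_s,L_t) - ln Z_1(L_s,L_t)| ≤ 12 · L_s³ L_t · (4·97²e·N|β|)^{L_s²}` — the asymmetric-box twin of
`CentralTwist.abs_log_twistZ_sub_log_twistZ_le_pow`. [cite: ItoSeiler2008Further, §2 Thm 2.2 (1)] [cite: Tomboulis2007Confinement, §6.2 eq. (6.12)] -/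
theorem abs_log_twistedPartitionFunctionAniso_sub_le_pow [NeZero Ls] (hρ : Continuous ρ) {β : ℝ}
    (hβ0 : 0 < (N : ℝ) * |β|) (hβ : (N : ℝ) * |β| ≤ 1 / (4 * ((97 : ℝ) ^ 2 * Real.exp 2))) {z : G} (hz : z ∈ Subgroup.center G) :
    |Real.log (twistedPartitionFunctionAniso ρ β Ls Lt z ⟨((0 : Fin 4), (1 : Fin 4)), by decide⟩) -
        Real.log (twistedPartitionFunctionAniso ρ β Ls Lt 1 ⟨((0 : Fin 4), (1 : Fin 4)), by decide⟩)| ≤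
      12 * ((Ls : ℝ) ^ 3 * Lt) * (4 * (97 : ℝ) ^ 2 * Real.exp 1 * (N * |β|)) ^ (Ls ^ 2) := by
  set κ : ℝ := 4 * (97 : ℝ) ^ 2 * Real.exp 1 * (N * |β|) with hκ
  have hκ0 : 0 < κ := by positivity
  have he1 : (1 : ℝ) ≤ Real.exp 1 := Real.one_le_exp (by norm_num)
  have hκe : κ * Real.exp 1 ≤ 1 := by
    have h := hβ
    rw [le_div_iff₀ (by positivity)] at h
    have : Real.exp 1 * Real.exp 1 = Real.exp 2 := by rw [← Real.exp_add]; norm_num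
    nlinarith [Real.exp_pos 1, Real.exp_pos 2]
  have hκ1 : κ ≤ 1 := by nlinarith
  set τ : ℝ := -Real.log κ with hτdef
  have hexpτ : Real.exp (-τ) = κ := by rw [hτdef, neg_neg, Real.exp_log hκ0]
  have hexpτ' : Real.exp τ = κ⁻¹ := by
    have h := hexpτ
    rw [Real.exp_neg] at h
    rw [← h, inv_inv]
  have hτ1 : 1 ≤ τ := by
    have hk : κ ≤ Real.exp (-1) := by
      rw [Real.exp_neg, ← one_div]
      exact (le_div_iff₀ (Real.exp_pos 1)).2 hκe
    have hlog : Real.log κ ≤ -1 := (Real.log_le_iff_le_exp hκ0).2 hk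
    rw [hτdef]
    linarith
  have hNβ1 : (N : ℝ) * |β| ≤ 1 := by
    have : 1 / (4 * ((97 : ℝ) ^ 2 * Real.exp 2)) ≤ 1 := by
      rw [div_le_iff₀ (by positivity)]
      nlinarith [Real.one_le_exp (show (0:ℝ) ≤ 2 by norm_num)]
    linarith
  have hsmall : ((97 : ℝ)) ^ 2 * (Real.exp (1 + τ) * (2 * N * |β|)) ≤ 1 / 2 := by
    have hexp : Real.exp (1 + τ) = Real.exp 1 * κ⁻¹ := by rw [Real.exp_add, hexpτ']
    have hx : (N : ℝ) * |β| ≠ 0 := hβ0.ne'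
    have hN : (N : ℝ) ≠ 0 := (mul_ne_zero_iff.1 hx).1
    have hb : |β| ≠ 0 := (mul_ne_zero_iff.1 hx).2
    have hval : ((97 : ℝ)) ^ 2 * (Real.exp 1 * κ⁻¹ * (2 * N * |β|)) = 1 / 2 := by
      rw [hκ]
      have he : Real.exp 1 ≠ 0 := (Real.exp_pos 1).ne'
      field_simp
      ring
    rw [hexp, hval]
  have h := abs_log_twistedPartitionFunctionAniso_sub_le_rate (Ls := Ls) (Lt := Lt) ρ hρ hτ1 hNβ1 hsmall hz
  refine h.trans (le_of_eq ?_)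
  congr 1
  rw [← hexpτ, ← Real.exp_nat_mul]
  congr 1
  push_cast
  ring

end Literature.MathematicalPhysics.QuantumFieldTheory

end
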